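import Summits.AtomisticToContinuum.Crystallization.Theorems.ChartedZeroExcessLayeredLatticeLiouvilleTH
import Summits.AtomisticToContinuum.Crystallization.Theorems.ChartedZeroExcessLayeredLatticeLiouvilleTearFreeDoor
import Summits.AtomisticToContinuum.Crystallization.Theorems.ChartedZeroExcessLayeredLatticeLiouvilleTearFreeShells
import Summits.AtomisticToContinuum.Crystallization.Theorems.PricedLinkCensusSoftLayerPropagationRealBallCovering

/-!
# Zero-excess layered lattice Liouville — piece (B4) `BondIsoTearFreeP 1` PROVED (decomp-a2c, prover hand 1, generation 16; critic row 603 (2)(b):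
# line-first prover task on (B4) of lens-2 g35's node «TransplantAndPin», skeleton T1–T3)

★★★ `bondIsoTearFreeP_one : BondIsoTearFreeP 1` — the hypothesis `h4` of part TH's column `gap_and_pert_1_50_of_certs_16XH10` is a THEOREM.

Proof = the skeleton: T3 + the door (`…TearFreeDoor.tearFree_of_cleanBondPath`), T2 = the gap lemma of `…TearFreeShells` (in a `(1/16, 9/10, 1)`-clean set two
sites at distance `≤ 6/5` are bonded), and T1 = ★ `cleanBondPath_one : CleanBondPath 1` proved HERE by the GREEDY FIRST-SHELL WALK:

* one move (`exists_move`): at a site `y` (chart scale `a ∈ [9/10, 1]`, pattern fcc or hcp) the `45°` cap lemma of the tree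
  (`…PricedLinkCensusSoftLayerPropagationRealBallCovering`, `RealBall.exists_mem_pattern_norm_le_inner`, BOTH kissing patterns) gives a first-shell chart
  point `y'` (a bond, `dist ≤ 17a/16`) with `dist p y' ≤ t + a/16` whenever `dist p y² − √2·a·dist p y + a² ≤ t²`;
* the arithmetic of one move (`descend`): with `√2 ≥ 1.41421356`, monotonicity in the distance and CONVEXITY IN THE SCALE `a` (the defect
  `D² − √2aD + a² − (r − a/16)²` is a convex quadratic in `a`, so the two endpoint checks `a = 9/10`, `a = 1` suffice), a move from distance `≤ rₙ` lands
  within `rₙ₋₁` along the ladder `r = 6/5, 793/500, 2027/1000, 2501/1000, 749/250, 1753/500, 2013/500` (twelve rational inequalities, `norm_num`);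
* the ladder (`level_succ`, six times) + the gap lemma at the bottom: Euclid `≤ 4 ≤ 2013/500` ⇒ at most `6 + 1 = 7` bonds.
(The planned second-shell moves of NODE-g35 §4 are NOT needed once the terminal step uses the gap lemma `6/5 ↦ 1 bond` instead of `27/20 ↦ 2 bonds`; the margin
at the top is `2013/500 − 4 = 0.026`.)  All `[folklore]`; 0 sorry; no new definitions.
-/

noncomputable section

open Set Metric
open scoped RealInnerProductSpace
open Summit.AtomisticToContinuum.Crystallization.Theorems.ChartedPlanarOrderRigidityDoor (E3 IsClean)
open Summit.AtomisticToContinuum.Crystallization.Theorems.ChartedPlanarOrderDensityDichotomy (μS)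
open Summit.AtomisticToContinuum.Crystallization.Theorems.ChartedPlanarOrderCleanScaleP (IsCleanP isCleanP_one_iff)
open Literature.Geometry.DiscreteGeometry (IsTwoShellGoodSet fccTwoShellPattern hcpTwoShellPattern fccKissingPattern hcpKissingPattern
  fccKissingPattern_subset hcpKissingPattern_subset norm_eq_one_of_mem_fccKissingPattern norm_eq_one_of_mem_hcpKissingPattern)
open Summit.AtomisticToContinuum.Crystallization.Theorems.RealBall (exists_mem_pattern_norm_le_inner)

namespace Summit.AtomisticToContinuum.Crystallization.Theorems.ChartedZeroExcessLayeredLatticeLiouville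

/-! ## §XVI.1  One move of the greedy walk -/

/-- squared distance to a displaced point: `dist p (x + e)² = dist p x² − 2⟪e, p − x⟫ + ‖e‖²`. [folklore] -/
theorem dist_sq_add_displace (p x e : E3) : dist p (x + e) ^ 2 = dist p x ^ 2 - 2 * ⟪e, p - x⟫ + ‖e‖ ^ 2 := by
  rw [dist_eq_norm, dist_eq_norm, show p - (x + e) = (p - x) - e by abel, norm_sub_sq_real, real_inner_comm]

/-- rotating the target into the chart frame: for a linear isometry `A` of `ℝ³` and any `z` there is `u` with `A u = z` and `‖u‖ = ‖z‖`. [folklore] -/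
theorem exists_preimage_linearIsometry (A : E3 →ₗᵢ[ℝ] E3) (z : E3) : ∃ u : E3, A u = z ∧ ‖u‖ = ‖z‖ := by
  let e : E3 ≃ₗᵢ[ℝ] E3 := A.toLinearIsometryEquiv rfl
  refine ⟨e.symm z, ?_, e.symm.norm_map z⟩
  show A (e.symm z) = z
  rw [← LinearIsometry.toLinearIsometryEquiv_apply A rfl, LinearIsometryEquiv.apply_symm_apply]

/-- ★ **ONE MOVE**: at a site `y` of a `(1/16, 9/10, 1)`-clean `S` there are a scale `a ∈ [9/10, 1]` and a BONDED site `y' ∈ S` (`dist y' y ≤ 28/25`) towards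
any target `p`: `dist p y' ≤ t + a/16` for every `t ≥ 0` with `dist p y² − √2·a·dist p y + a² ≤ t²` (the first-shell chart point within `45°` of `p − y`,
by the tree's cap lemma for BOTH kissing patterns). [folklore] -/
theorem exists_move {S : Set E3} (hS : IsCleanP 1 (μS S)) {y : E3} (hy : y ∈ S) (p : E3) :
    ∃ a : ℝ, 9 / 10 ≤ a ∧ a ≤ 1 ∧ ∃ y' ∈ S, dist y' y ≤ 28 / 25 ∧
      ∀ t : ℝ, 0 ≤ t → dist p y ^ 2 - Real.sqrt 2 * a * dist p y + a ^ 2 ≤ t ^ 2 → dist p y' ≤ t + 1 / 16 * a := by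
  obtain ⟨a, ha₁, ha₂, A, P, f, hP, hf, -, -⟩ := twoShellGood_of_isCleanP_one hS hy
  have ha0 : 0 ≤ a := by linarith
  -- the kissing pattern inside the chart's pattern
  obtain ⟨K, hK, hKP, hK1⟩ : ∃ K : Finset E3, (K = fccKissingPattern ∨ K = hcpKissingPattern) ∧ K ⊆ P ∧ ∀ v ∈ K, ‖v‖ = 1 := by
    rcases hP with rfl | rfl
    · exact ⟨fccKissingPattern, Or.inl rfl, fccKissingPattern_subset, fun v hv => norm_eq_one_of_mem_fccKissingPattern hv⟩
    · exact ⟨hcpKissingPattern, Or.inr rfl, hcpKissingPattern_subset, fun v hv => norm_eq_one_of_mem_hcpKissingPattern hv⟩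
  obtain ⟨u, hAu, hu⟩ := exists_preimage_linearIsometry A (p - y)
  obtain ⟨v, hvK, hvu⟩ := exists_mem_pattern_norm_le_inner hK u
  have hv : v ∈ P := hKP hvK
  have hv1 : ‖v‖ = 1 := hK1 v hvK
  obtain ⟨hyS, hclose⟩ := hf v hv
  refine ⟨a, ha₁, ha₂, f v, hyS, ?_, ?_⟩
  · -- a bond: `dist (f v) y ≤ a + a/16 ≤ 17/16`
    have hc : dist (y + a • A v) y = a := by
      rw [dist_eq_norm, add_sub_cancel_left, norm_smul, Real.norm_of_nonneg ha0, A.norm_map, hv1, mul_one]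
    linarith [dist_triangle (f v) (y + a • A v) y]
  · intro t ht hQ
    -- `dist p y ≤ √2·⟪A v, p − y⟫` (the cap lemma, rotated into the chart frame)
    have hvu' : dist p y ≤ Real.sqrt 2 * ⟪A v, p - y⟫ := by
      rw [← hAu, A.inner_map_map, dist_eq_norm, ← hu]; exact hvu
    have hs2 : Real.sqrt 2 * Real.sqrt 2 = 2 := Real.mul_self_sqrt (by norm_num)
    have hmid : dist p (y + a • A v) ^ 2 ≤ t ^ 2 := by
      rw [dist_sq_add_displace, real_inner_smul_left, norm_smul, Real.norm_of_nonneg ha0, A.norm_map, hv1, mul_one]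
      have h2 : Real.sqrt 2 * a * dist p y ≤ 2 * (a * ⟪A v, p - y⟫) := by
        have h3 := mul_le_mul_of_nonneg_left hvu' (mul_nonneg (Real.sqrt_nonneg 2) ha0)
        have e : Real.sqrt 2 * a * (Real.sqrt 2 * ⟪A v, p - y⟫) = 2 * (a * ⟪A v, p - y⟫) := by
          linear_combination (a * ⟪A v, p - y⟫) * hs2
        linarith [e]
      linarith
    have hmid' : dist p (y + a • A v) ≤ t := (pow_le_pow_iff_left₀ dist_nonneg ht two_ne_zero).1 hmid
    have := dist_triangle p (y + a • A v) (f v)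
    rw [dist_comm (y + a • A v) (f v)] at this
    linarith

/-! ## §XVI.2  The arithmetic of one move -/

/-- `1.41421356 ≤ √2`. [folklore] -/
theorem sqrt_two_ge : (141421356 : ℝ) / 100000000 ≤ Real.sqrt 2 :=
  le_of_lt ((Real.lt_sqrt (by norm_num)).mpr (by norm_num))

/-- ★ **DESCENT ARITHMETIC**: if the two ENDPOINT checks `rₙ² − 1.41421356·(9/10)·rₙ + 81/100 ≤ (r − 9/160)²` and `rₙ² − 1.41421356·rₙ + 1 ≤ (r − 1/16)²` hold and
`1/16 ≤ r`, `3/4 ≤ D ≤ rₙ`, then for EVERY scale `a ∈ [9/10, 1]`: `D² − √2·a·D + a² ≤ (r − a/16)²` (convexity in `a`, monotonicity in `D`). [folklore] -/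
theorem descend {D a r rn : ℝ} (ha : 9 / 10 ≤ a) (ha1 : a ≤ 1) (hD : 3 / 4 ≤ D) (hDn : D ≤ rn)
    (h9 : rn ^ 2 - 141421356 / 100000000 * (9 / 10) * rn + (9 / 10) ^ 2 ≤ (r - 9 / 160) ^ 2)
    (h1 : rn ^ 2 - 141421356 / 100000000 * rn + 1 ≤ (r - 1 / 16) ^ 2) :
    D ^ 2 - Real.sqrt 2 * a * D + a ^ 2 ≤ (r - 1 / 16 * a) ^ 2 := by
  set c : ℝ := 141421356 / 100000000 with hc
  have hcs : c ≤ Real.sqrt 2 := sqrt_two_ge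
  have ha0 : 0 ≤ a := by linarith
  have hD0 : 0 ≤ D := by linarith
  -- replace `√2` by `c`
  have e1 : D ^ 2 - Real.sqrt 2 * a * D + a ^ 2 ≤ D ^ 2 - c * a * D + a ^ 2 := by
    nlinarith [mul_nonneg ha0 hD0]
  -- monotone in `D` on `[3/4, rn]` (`rn + D ≥ c·a`)
  have e2 : D ^ 2 - c * a * D ≤ rn ^ 2 - c * a * rn := by
    have : 0 ≤ (rn - D) * (rn + D - c * a) := mul_nonneg (by linarith) (by rw [hc]; nlinarith)
    nlinarith
  -- convex in `a`: interpolate between the endpoint checks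
  have key : rn ^ 2 - c * a * rn + a ^ 2 - (r - 1 / 16 * a) ^ 2 =
      10 * (1 - a) * (rn ^ 2 - c * (9 / 10) * rn + (9 / 10) ^ 2 - (r - 9 / 160) ^ 2) +
        10 * (a - 9 / 10) * (rn ^ 2 - c * rn + 1 - (r - 1 / 16) ^ 2) + 255 / 256 * (a - 9 / 10) * (a - 1) := by
    ring
  have e3 : 255 / 256 * (a - 9 / 10) * (a - 1) ≤ 0 := by
    have : (a - 9 / 10) * (a - 1) ≤ 0 := mul_nonpos_of_nonneg_of_nonpos (by linarith) (by linarith)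
    nlinarith
  have e4 : 10 * (1 - a) * (rn ^ 2 - c * (9 / 10) * rn + (9 / 10) ^ 2 - (r - 9 / 160) ^ 2) ≤ 0 :=
    mul_nonpos_of_nonneg_of_nonpos (by linarith) (by rw [hc]; linarith)
  have e5 : 10 * (a - 9 / 10) * (rn ^ 2 - c * rn + 1 - (r - 1 / 16) ^ 2) ≤ 0 :=
    mul_nonpos_of_nonneg_of_nonpos (by linarith) (by rw [hc]; linarith)
  have e6 : rn ^ 2 - c * a * rn + a ^ 2 - (r - 1 / 16 * a) ^ 2 ≤ 0 := by rw [key]; linarith [e3, e4, e5]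
  calc D ^ 2 - Real.sqrt 2 * a * D + a ^ 2 ≤ D ^ 2 - c * a * D + a ^ 2 := e1
    _ ≤ rn ^ 2 - c * a * rn + a ^ 2 := add_le_add_left e2 _
    _ ≤ (r - 1 / 16 * a) ^ 2 := sub_nonpos.1 e6

/-! ## §XVI.3  Chains: prepending a bond, the bottom level, the ladder -/

/-- prepending one bond to a chain (the new chain is `y, z 0, z 1, …`). [folklore] -/
theorem isBondChain_cons {S : Set E3} {y y' p : E3} {k : ℕ} {z : ℕ → E3} (hz : IsBondChain S y' p k z) (hy : y ∈ S) (hd : dist y' y ≤ 28 / 25) :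
    IsBondChain S y p (k + 1) (fun i => Nat.rec (motive := fun _ => E3) y (fun j _ => z j) i) := by
  obtain ⟨h0, hk, hmem, hbond⟩ := hz
  refine ⟨rfl, hk, fun i hi => ?_, fun i hi => ?_⟩
  · cases i with
    | zero => exact hy
    | succ j => exact hmem j (by omega)
  · cases i with
    | zero => show dist (z 0) y ≤ 28 / 25; rw [h0]; exact hd
    | succ j => exact hbond j (by omega)

/-- **level 1**: a target within `6/5` is one bond away (the gap lemma). [folklore] -/
theorem level_one {S : Set E3} (hS : IsCleanP 1 (μS S)) {p : E3} (hp : p ∈ S) :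
    ∀ y ∈ S, dist p y ≤ 6 / 5 → ∃ (k : ℕ) (z : ℕ → E3), k ≤ 1 ∧ IsBondChain S y p k z := by
  intro y hy hd
  have hb : dist p y ≤ 17 / 16 := dist_le_of_dist_le_six_fifths hS hy hp hd
  refine ⟨1, fun i => Nat.rec (motive := fun _ => E3) y (fun _ _ => p) i, le_rfl, rfl, rfl, fun i hi => ?_, fun i hi => ?_⟩
  · cases i with
    | zero => exact hy
    | succ j => exact hp
  · cases i with
    | zero => show dist p y ≤ 28 / 25; linarith
    | succ j => omega

/-- ★ **THE LADDER STEP**: if every site within `r` of the target reaches it in `≤ n` bonds, and the two endpoint checks of `descend` hold for `(rₙ, r)` (`r ≥ 6/5`),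
then every site within `rₙ` reaches it in `≤ n + 1` bonds. [folklore] -/
theorem level_succ {S : Set E3} (hS : IsCleanP 1 (μS S)) {p : E3} {r rn : ℝ} {n : ℕ} (hr : 6 / 5 ≤ r)
    (h9 : rn ^ 2 - 141421356 / 100000000 * (9 / 10) * rn + (9 / 10) ^ 2 ≤ (r - 9 / 160) ^ 2)
    (h1 : rn ^ 2 - 141421356 / 100000000 * rn + 1 ≤ (r - 1 / 16) ^ 2)
    (IH : ∀ y ∈ S, dist p y ≤ r → ∃ (k : ℕ) (z : ℕ → E3), k ≤ n ∧ IsBondChain S y p k z) :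
    ∀ y ∈ S, dist p y ≤ rn → ∃ (k : ℕ) (z : ℕ → E3), k ≤ n + 1 ∧ IsBondChain S y p k z := by
  intro y hy hd
  by_cases hle : dist p y ≤ r
  · obtain ⟨k, z, hk, hz⟩ := IH y hy hle
    exact ⟨k, z, by omega, hz⟩
  · push Not at hle
    obtain ⟨a, ha, ha1, y', hy', hbond, hmove⟩ := exists_move hS hy p
    have ht0 : 0 ≤ r - 1 / 16 * a := by linarith
    have hQ := descend ha ha1 (by linarith) hd h9 h1
    have hdist : dist p y' ≤ r := by
      have := hmove (r - 1 / 16 * a) ht0 hQ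
      linarith
    obtain ⟨k, z, hk, hz⟩ := IH y' hy' hdist
    exact ⟨k + 1, _, by omega, isBondChain_cons hz hy hbond⟩

/-! ## §XVI.4  T1 and (B4) -/

/-- ★★ **T1: `CleanBondPath 1`** — in a `(1/16, 9/10, 1)`-clean configuration two sites at Euclidean distance `≤ 4` are joined by a chain of at most `7` bonds
(greedy first-shell walk down the ladder `2013/500 → 1753/500 → 749/250 → 2501/1000 → 2027/1000 → 793/500 → 6/5`, then the gap lemma). [folklore] -/
theorem cleanBondPath_one : CleanBondPath 1 := by
  intro S hS x hx p hp hd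
  have L1 := level_one hS hp
  have L2 := level_succ hS (r := 6 / 5) (rn := 793 / 500) (n := 1) (by norm_num) (by norm_num) (by norm_num) L1
  have L3 := level_succ hS (r := 793 / 500) (rn := 2027 / 1000) (n := 2) (by norm_num) (by norm_num) (by norm_num) L2
  have L4 := level_succ hS (r := 2027 / 1000) (rn := 2501 / 1000) (n := 3) (by norm_num) (by norm_num) (by norm_num) L3
  have L5 := level_succ hS (r := 2501 / 1000) (rn := 749 / 250) (n := 4) (by norm_num) (by norm_num) (by norm_num) L4
  have L6 := level_succ hS (r := 749 / 250) (rn := 1753 / 500) (n := 5) (by norm_num) (by norm_num) (by norm_num) L5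
  have L7 := level_succ hS (r := 1753 / 500) (rn := 2013 / 500) (n := 6) (by norm_num) (by norm_num) (by norm_num) L6
  obtain ⟨k, z, hk, hz⟩ := L7 x hx (by linarith)
  exact ⟨k, z, by omega, hz⟩

/-- ★★★ **(B4) PROVED**: `BondIsoTearFreeP 1` — a bijective bond isomorphism between a `1`-clean configuration and a clean one is two-sided tear-free at `4 ↦ 8`
(part TH, lens-2 g35; hypothesis `h4` of `gap_and_pert_1_50_of_certs_16XH10`). [folklore] -/
theorem bondIsoTearFreeP_one : BondIsoTearFreeP 1 := tearFree_of_cleanBondPath cleanBondPath_one cleanBondPath_one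

end Summit.AtomisticToContinuum.Crystallization.Theorems.ChartedZeroExcessLayeredLatticeLiouville

end
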